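import Literature.Algebra.EuclideanLattices.ThetaInvariants
import HarnessLib

/-!
# Monotonicity of Bost's theta invariants under finite-index sublattices
# (`h⁰_θ(Ē) ≤ h⁰_θ(F̄)`, `h¹_θ(F̄) ≤ h¹_θ(Ē)`, and the `log |F/E|` bounds)

Topic `Literature/Algebra/EuclideanLattices`; theorems only (no definition, no named fact),
continuing `ThetaInvariants.lean` (`hZeroTheta`, `hOneTheta`, `arakelovDegree`).

For two Euclidean lattices `Ē ⊆ F̄` in the same Euclidean space (`E ≤ F` full-rank discrete
`ℤ`-submodules of `V`, induced norms — i.e. the inclusion `φ : E → F` is a morphism of norm `≤ 1`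
with `φ_ℚ` bijective, the case of [Bost2015, Prop. 3.3.2 and Cor. 3.3.4] where `E_K = F_K`):

* `hZeroTheta_mono` — **`h⁰_θ(Ē) ≤ h⁰_θ(F̄)`** [Bost2015, Prop. 3.3.2 (1), eq. (monothot)]
  (a sub-sum of a series of positive terms), with the equality clause
  `hZeroTheta_lt_of_lt` / `hZeroTheta_eq_iff` — equality iff `E = F` [Bost2015, Prop. 3.3.2,
  "Moreover …"];
* `hOneTheta_anti` — **`h¹_θ(F̄) ≤ h¹_θ(Ē)`** [Bost2015, Prop. 3.3.2 (2), eq. (monothut)]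
  (duality reverses inclusions: `F^∨ ≤ E^∨`);
* `arakelovDegree_sub_eq_log_relIndex` — **`deg^ F̄ − deg^ Ē = log |F/E|`** [Bost2015, proof of
  Cor. 3.3.4] (Mathlib's `ZLattice.covolume_div_covolume_eq_relIndex'`:
  `covol(E)/covol(F) = [F : E]`);
* `hZeroTheta_sub_log_relIndex_le`, `hOneTheta_le_add_log_relIndex` — **Corollary 3.3.4**:
  `h⁰_θ(F̄) − log|F/E| ≤ h⁰_θ(Ē) ≤ h⁰_θ(F̄)` and `h¹_θ(F̄) ≤ h¹_θ(Ē) ≤ h¹_θ(F̄) + log|F/E|`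
  [Bost2015, Cor. 3.3.4] (from the two monotonicities and Poisson–Riemann–Roch).

Not treated: morphisms `φ` other than inclusions of lattices in one Euclidean space (general
`Hom^{≤1}(Ē, F̄)`, heights `ht(∧ⁿĒ, ∧ⁿF̄, det φ_K)` of [Bost2015, Prop. 3.3.3]), number fields
`K ≠ ℚ`, and the twists `Ē ⊗ Ō(−δ)` of [Bost2015, Cor. 3.3.5].

## References

* J.-B. Bost, *Theta invariants of Euclidean lattices and infinite-dimensional Hermitian vector
  bundles over arithmetic curves*, arXiv:1512.08946, Prop. 3.3.2, Cor. 3.3.4 [Bost2015]; Progress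
  in Math. 334 (2020) [Bost2020].
-/

noncomputable section

open MeasureTheory Module Real

namespace Literature.Algebra.EuclideanLattices

variable {V : Type*} [NormedAddCommGroup V] [InnerProductSpace ℝ V] [FiniteDimensional ℝ V]
  [MeasurableSpace V] [BorelSpace V]
variable (E F : Submodule ℤ V) [DiscreteTopology E] [IsZLattice ℝ E] [DiscreteTopology F]
  [IsZLattice ℝ F]

/-! ## `h⁰_θ` increases and `h¹_θ` decreases along inclusions -/

omit [MeasurableSpace V] [BorelSpace V] [IsZLattice ℝ E] [IsZLattice ℝ F] in
/-- The theta series of a sublattice is at most that of the lattice: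
`Σ_{v ∈ E} e^{−π‖v‖²} ≤ Σ_{w ∈ F} e^{−π‖w‖²}` for `E ≤ F` (display (phiinjective) in the proof of
[Bost2015, Prop. 3.3.2]). [cite: Bost2015, Prop. 3.3.2 (1) (proof)] -/
theorem tsum_gaussianFunction_one_le_of_le (h : E ≤ F) :
    ∑' v : E, gaussianFunction 1 (v : V) ≤ ∑' w : F, gaussianFunction 1 (w : V) :=
  Summable.tsum_le_tsum_of_inj (Submodule.inclusion h) (Submodule.inclusion_injective h)
    (fun c _ => (gaussianFunction_pos _ _).le) (fun b => by rw [Submodule.coe_inclusion])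
    (summable_gaussianFunction_one E) (summable_gaussianFunction_one F)

omit [MeasurableSpace V] [BorelSpace V] [IsZLattice ℝ E] [IsZLattice ℝ F] in
/-- **`h⁰_θ(Ē) ≤ h⁰_θ(F̄)` for `E ≤ F`** (Bost's Prop. 3.3.2 (1) for the inclusion morphism).
[cite: Bost2015, Prop. 3.3.2 (1)] -/
theorem hZeroTheta_mono (h : E ≤ F) : hZeroTheta E ≤ hZeroTheta F :=
  Real.log_le_log (tsum_gaussianFunction_one_pos E) (tsum_gaussianFunction_one_le_of_le E F h)

omit [MeasurableSpace V] [BorelSpace V] in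
/-- **`h¹_θ(F̄) ≤ h¹_θ(Ē)` for `E ≤ F`** (Bost's Prop. 3.3.2 (2) for the inclusion morphism, whose
generic fibre is surjective; proof: `F^∨ ≤ E^∨`). [cite: Bost2015, Prop. 3.3.2 (2)] -/
theorem hOneTheta_anti (h : E ≤ F) : hOneTheta F ≤ hOneTheta E :=
  hZeroTheta_mono (dualLattice F) (dualLattice E) (dualLattice_anti h)

/-! ## The equality clause: `h⁰_θ` detects equality of nested lattices -/

omit [MeasurableSpace V] [BorelSpace V] [DiscreteTopology E] [IsZLattice ℝ E] [IsZLattice ℝ F] in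
/-- For a PROPER sublattice `E < F` the theta series strictly increases (a vector `w ∈ F ∖ E`
contributes `e^{−π‖w‖²} > 0`). [cite: Bost2015, Prop. 3.3.2 (equality clause)] -/
theorem tsum_gaussianFunction_one_lt_of_lt (h : E < F) :
    ∑' v : E, gaussianFunction 1 (v : V) < ∑' w : F, gaussianFunction 1 (w : V) := by
  classical
  obtain ⟨w, hwF, hwE⟩ := SetLike.exists_of_lt h
  have hle : E ≤ F := h.le
  have hsF := summable_gaussianFunction_one F
  -- split the sum over `F` along `s = {x ∈ F : x ∈ E}`
  let s : Set F := {x | (x : V) ∈ E}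
  have hsplit := hsF.tsum_subtype_add_tsum_subtype_compl s
  -- the part over `s` is the sum over `E`
  let e : E ≃ s :=
    { toFun := fun v => ⟨⟨(v : V), hle v.2⟩, v.2⟩
      invFun := fun x => ⟨((x : F) : V), x.2⟩
      left_inv := fun v => by ext; rfl
      right_inv := fun x => by ext; rfl }
  have hs_eq : ∑' x : s, gaussianFunction 1 ((x : F) : V) = ∑' v : E, gaussianFunction 1 (v : V) := by
    rw [← e.tsum_eq]
    rfl
  -- the complementary part contains `w` and is positive
  have hwc : (⟨w, hwF⟩ : F) ∈ sᶜ := hwE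
  have hcsum : Summable fun x : (sᶜ : Set F) => gaussianFunction 1 ((x : F) : V) :=
    hsF.subtype _
  have hpos : 0 < ∑' x : (sᶜ : Set F), gaussianFunction 1 ((x : F) : V) :=
    lt_of_lt_of_le (gaussianFunction_pos 1 (w : V))
      (hcsum.le_tsum ⟨⟨w, hwF⟩, hwc⟩ fun j _ => (gaussianFunction_pos _ _).le)
  rw [← hsplit, hs_eq]
  linarith

omit [MeasurableSpace V] [BorelSpace V] [IsZLattice ℝ E] [IsZLattice ℝ F] in
/-- **`h⁰_θ(Ē) < h⁰_θ(F̄)` for a proper sublattice `E < F`.**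
[cite: Bost2015, Prop. 3.3.2 (equality clause)] -/
theorem hZeroTheta_lt_of_lt (h : E < F) : hZeroTheta E < hZeroTheta F :=
  Real.log_lt_log (tsum_gaussianFunction_one_pos E) (tsum_gaussianFunction_one_lt_of_lt E F h)

omit [MeasurableSpace V] [BorelSpace V] [IsZLattice ℝ E] [IsZLattice ℝ F] in
/-- **Equality clause of Prop. 3.3.2 (1)** for nested lattices `E ≤ F`: `h⁰_θ(Ē) = h⁰_θ(F̄)` iff
`E = F` (i.e. iff the inclusion is an isometric isomorphism).
[cite: Bost2015, Prop. 3.3.2 (equality clause)] -/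
theorem hZeroTheta_eq_iff (h : E ≤ F) : hZeroTheta E = hZeroTheta F ↔ E = F := by
  refine ⟨fun heq => ?_, fun heq => by subst heq; rfl⟩
  by_contra hne
  exact (hZeroTheta_lt_of_lt E F (lt_of_le_of_ne h hne)).ne heq

/-! ## Corollary 3.3.4: the `log |F/E|` bounds -/

/-- **`deg^ F̄ − deg^ Ē = log |F/E|`** for full lattices `E ≤ F` in one Euclidean space
(`covol(E) = [F:E] · covol(F)`; the computation `−ht(∧ⁿĒ, ∧ⁿF̄, det φ_K) = log|F/E|` in the
proof of Bost's Cor. 3.3.4). [cite: Bost2015, Cor. 3.3.4 (proof)] -/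
theorem arakelovDegree_sub_eq_log_relIndex (h : E ≤ F) :
    arakelovDegree F - arakelovDegree E =
      Real.log (E.toAddSubgroup.relIndex F.toAddSubgroup : ℕ) := by
  have hq := ZLattice.covolume_div_covolume_eq_relIndex' E F h
  rw [arakelovDegree, arakelovDegree, ← hq,
    Real.log_div (ZLattice.covolume_pos E volume).ne' (ZLattice.covolume_pos F volume).ne']
  ring

/-- **Corollary 3.3.4, first line**: `h⁰_θ(F̄) − log|F/E| ≤ h⁰_θ(Ē)` (`≤ h⁰_θ(F̄)` is
`hZeroTheta_mono`). [cite: Bost2015, Cor. 3.3.4] -/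
theorem hZeroTheta_sub_log_relIndex_le (h : E ≤ F) :
    hZeroTheta F - Real.log (E.toAddSubgroup.relIndex F.toAddSubgroup : ℕ) ≤ hZeroTheta E := by
  have h1 := hZeroTheta_sub_hOneTheta E
  have h2 := hZeroTheta_sub_hOneTheta F
  have h3 := hOneTheta_anti E F h
  have h4 := arakelovDegree_sub_eq_log_relIndex E F h
  linarith

/-- **Corollary 3.3.4, second line**: `h¹_θ(Ē) ≤ h¹_θ(F̄) + log|F/E|` (`h¹_θ(F̄) ≤ h¹_θ(Ē)` is
`hOneTheta_anti`). [cite: Bost2015, Cor. 3.3.4] -/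
theorem hOneTheta_le_add_log_relIndex (h : E ≤ F) :
    hOneTheta E ≤ hOneTheta F + Real.log (E.toAddSubgroup.relIndex F.toAddSubgroup : ℕ) := by
  have h1 := hZeroTheta_sub_hOneTheta E
  have h2 := hZeroTheta_sub_hOneTheta F
  have h3 := hZeroTheta_mono E F h
  have h4 := arakelovDegree_sub_eq_log_relIndex E F h
  linarith

end Literature.Algebra.EuclideanLattices

end
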